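import Summits.Ventures.YMGap.FlowData.RectTubeMagneticTwistFlatness
import Summits.Ventures.YMGap.FlowData.RectTubeKernelNearIdentity
import Summits.Ventures.YMGap.FlowData.RankOneSecondOrder
import HarnessLib

/-!
# Venture YMGap, track Y3 FLOW-DATA — the top eigenvalue of the (twisted) tube operator to SECOND ORDER in the distance to the
# rank-one projection: `|‖T_ζ‖ − (∫∫K_ζ + Var_a ∫K_ζ(a,·))| ≤ 4 η³`, `η = e^{|J| n (3#P+N)} − 1` (theorems only)

HONEST FRAMING: venture file of the cell `pub-ymgap` (QuantumFields programme), track Y3 (FLOW-DATA); companion THEOREMS for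
`FlowData/RectTubeMagneticTwist.lean` (the twisted tube operator `T_ζ`, `E_mag`) and `FlowData/RankOneSecondOrder.lean` (abstract
second-order perturbation of a rank-one projection).  Finite rectangular tube `Π ℤ/Lᵢ`, compact second-countable `G`, continuous
unitary `ρ`, ANY plaquette field `ζ` (so `ζ ≡ 1` covers the untwisted operator); small `|J|` (so that `η ≤ ¼`).  Nothing about
`L → ∞`, the continuum or a mass gap; no number of the FLOW-TABLE.

* `abs_rectSliceKernelTw_sub_one_le` — `|K_ζ(a,b) − 1| ≤ η := e^{|J| n (3#P+N)} − 1` (kernel pinch of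
  `RectTubeMagneticTwistFlatness`);
* **`norm_rectTubeTwistedOperator_sub_rankOne_le`** — `‖T_ζ ψ − ⟪1,ψ⟫ 1‖ ≤ η ‖ψ‖`;
* `exists_unit_top_eigenvector_rectTubeTwistedOperator` — a unit `φ₀` with `T_ζ φ₀ = ‖T_ζ‖ φ₀` (compactness + positivity
  improvement); `inner_rectTubeTwistedOperator_comm` — `⟪T_ζ x, y⟫ = ⟪x, T_ζ y⟫`;
* **`abs_norm_rectTubeTwistedOperator_sub_second_order_le`** — for `η ≤ ¼`:
  `|‖T_ζ‖ − (⟪1, T_ζ 1⟫ + ‖T_ζ 1 − ⟪1, T_ζ 1⟫ 1‖²)| ≤ 4 η³` (`RankOneSecondOrder.abs_norm_sub_second_order_le`);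
* `inner_one_rectTubeTwistedOperator_one_eq` — `⟪1, T_ζ 1⟫ = ∫∫ K_ζ(a,b) db da`; `norm_sq_rectTubeTwistedOperator_one_sub_eq` —
  `‖T_ζ 1 − ⟪1,T_ζ 1⟫ 1‖² = ∫ (∫ K_ζ(a,b) db − ∫∫K_ζ)² da` (the variance of the row integrals): the two scalar quantities whose
  `β`-expansions give the second-order strong-coupling laws.

References: T. Kato (1966) §II.2 [cite: Kato1966, §II.2]; M. Reed, B. Simon IV (1978) §XII.1, §XIII.12 [cite: ReedSimonIV1978, §XII.1];
I. Montvay, G. Münster (1994) §3.2.6 [cite: MontvayMunster1994, §3.2.6].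
-/

noncomputable section

open scoped BigOperators ENNReal InnerProductSpace
open MeasureTheory Filter Function Topology
open Literature.MathematicalPhysics.QuantumFieldTheory Literature.Analysis.OperatorTheory
open Literature.MathematicalPhysics.QuantumLattice (RectTorusSite)
open Literature.Barriers.QuantumFields
open Summit.Ventures.YMGap.Census (RectPlaquette)

namespace Summit.Ventures.YMGap.FlowData

section Twisted

variable {G : Type*} [Group G] [TopologicalSpace G] [IsTopologicalGroup G] [CompactSpace G]
  [MeasurableSpace G] [BorelSpace G] [SecondCountableTopology G] {n k : ℕ} (ρ : G →* Matrix (Fin n) (Fin n) ℂ)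
  (J : ℝ) {Ls : Fin k → ℕ} [∀ i, NeZero (Ls i)]

/-- **`|K_ζ(a,b) − 1| ≤ e^{|J| n (3#P+N)} − 1`** for the twisted slice kernel of a unitary `ρ` (from the two-sided pinch
`e^{−c} ≤ K_ζ ≤ e^{c}` and `1 − e^{−c} ≤ e^{c} − 1`). [folklore] -/
theorem abs_rectSliceKernelTw_sub_one_le (hρ : Continuous ρ) (hρu : ∀ g, ρ g ∈ Matrix.unitaryGroup (Fin n) ℂ)
    (ζ : RectPlaquette Ls → G) (a b : RectSlice Ls G) :
    |rectSliceKernelTw (Ls := Ls) ρ ζ J J a b - 1| ≤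
      Real.exp (|J| * (n * (3 * (Fintype.card (RectTorusSite Ls) * Fintype.card {p : Fin k × Fin k // p.1 < p.2}) +
        Fintype.card (RectTorusSite Ls × Fin k)))) - 1 := by
  set x : ℝ := |J| * (n * (3 * (Fintype.card (RectTorusSite Ls) * Fintype.card {p : Fin k × Fin k // p.1 < p.2}) +
        Fintype.card (RectTorusSite Ls × Fin k))) with hx
  obtain ⟨hlo, hhi⟩ := rectSliceKernelTw_mem_Icc_exp ρ (Ls := Ls) hρ hρu ζ J a b
  rw [← hx] at hlo hhi
  have hcosh : 1 - Real.exp (-x) ≤ Real.exp x - 1 := by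
    have h1 : Real.exp x * Real.exp (-x) = 1 := by rw [← Real.exp_add, add_neg_cancel, Real.exp_zero]
    nlinarith [Real.exp_pos x, Real.exp_pos (-x), sq_nonneg (Real.exp x - 1)]
  exact abs_sub_le_iff.2 ⟨by linarith, by linarith⟩

/-- **`‖T_ζ ψ − ⟪1,ψ⟫ 1‖ ≤ (e^{|J| n (3#P+N)} − 1)‖ψ‖`**: the twisted tube operator is within `η` (operator norm) of the
rank-one projection onto the constants (`T_ζ ψ − ⟪1,ψ⟫1 = ∫ (K_ζ − 1)ψ`, `(∫|ψ|)² ≤ ∫ψ²`). [folklore] -/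
theorem norm_rectTubeTwistedOperator_sub_rankOne_le (hρ : Continuous ρ) (hρu : ∀ g, ρ g ∈ Matrix.unitaryGroup (Fin n) ℂ)
    (ζ : RectPlaquette Ls → G) (ψ : Lp ℝ 2 (rectSliceMeasure G Ls)) :
    ‖rectTubeTwistedOperator ρ J Ls ζ ψ -
        (@inner ℝ _ _ (Lp.const 2 (rectSliceMeasure G Ls) (1 : ℝ)) ψ) • Lp.const 2 (rectSliceMeasure G Ls) (1 : ℝ)‖ ≤
      (Real.exp (|J| * (n * (3 * (Fintype.card (RectTorusSite Ls) * Fintype.card {p : Fin k × Fin k // p.1 < p.2}) +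
        Fintype.card (RectTorusSite Ls × Fin k)))) - 1) * ‖ψ‖ := by
  set η : ℝ := Real.exp (|J| * (n * (3 * (Fintype.card (RectTorusSite Ls) * Fintype.card {p : Fin k × Fin k // p.1 < p.2}) +
        Fintype.card (RectTorusSite Ls × Fin k)))) - 1 with hη
  have hη0 : 0 ≤ η := by
    rw [hη, sub_nonneg]
    exact Real.one_le_exp (by positivity)
  set one : Lp ℝ 2 (rectSliceMeasure G Ls) := Lp.const 2 (rectSliceMeasure G Ls) (1 : ℝ) with hone
  set d := rectTubeTwistedOperator ρ J Ls ζ ψ - (@inner ℝ _ _ one ψ) • one with hd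
  have hψi : Integrable (fun b => (ψ : RectSlice Ls G → ℝ) b) (rectSliceMeasure G Ls) :=
    (Lp.memLp ψ).integrable one_le_two
  -- `⟪1, ψ⟫ = ∫ ψ`
  have hinner : @inner ℝ _ _ one ψ = ∫ b, ψ b ∂(rectSliceMeasure G Ls) := by
    rw [inner_eq_integral]
    refine integral_congr_ae ?_
    filter_upwards [Lp.coeFn_const 2 (rectSliceMeasure G Ls) (1 : ℝ)] with b hb
    rw [← hone] at hb
    rw [hb, Function.const_apply, one_mul]
  -- the a.e. formula `d(a) = ∫ (K_ζ(a,b) − 1) ψ(b) db`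
  have hKi : ∀ a, Integrable (fun b => rectSliceKernelTw (Ls := Ls) ρ ζ J J a b * ψ b) (rectSliceMeasure G Ls) := by
    intro a
    obtain ⟨C, hC⟩ := exists_rectSliceKernelTw_le (Ls := Ls) ρ hρ ζ J J
    refine hψi.bdd_mul ?_ (Eventually.of_forall fun b => hC a b)
    exact ((continuous_rectSliceKernelTw (Ls := Ls) ρ hρ ζ J J).comp
      (Continuous.prodMk continuous_const continuous_id)).aestronglyMeasurable
  have hdae : (d : RectSlice Ls G → ℝ) =ᵐ[rectSliceMeasure G Ls]
      fun a => ∫ b, (rectSliceKernelTw (Ls := Ls) ρ ζ J J a b - 1) * ψ b ∂(rectSliceMeasure G Ls) := by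
    filter_upwards [Lp.coeFn_sub (rectTubeTwistedOperator ρ J Ls ζ ψ) ((@inner ℝ _ _ one ψ) • one),
      rectTubeTwistedOperator_ae_eq (J := J) hρ ζ ψ, Lp.coeFn_smul (@inner ℝ _ _ one ψ) one,
      Lp.coeFn_const 2 (rectSliceMeasure G Ls) (1 : ℝ)] with a ha hTa hsa h1a
    rw [hd, ha, Pi.sub_apply, hTa, hsa, Pi.smul_apply, ← hone] at *
    rw [h1a, Function.const_apply, smul_eq_mul, mul_one, hinner]
    simp_rw [sub_mul, one_mul]
    rw [integral_sub (hKi a) hψi]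
  -- pointwise `|d(a)| ≤ η ∫|ψ|`
  have hpt : ∀ a, |∫ b, (rectSliceKernelTw (Ls := Ls) ρ ζ J J a b - 1) * ψ b ∂(rectSliceMeasure G Ls)| ≤
      η * ∫ b, |ψ b| ∂(rectSliceMeasure G Ls) := by
    intro a
    rw [← integral_const_mul]
    refine (abs_integral_le_integral_abs).trans (integral_mono_of_nonneg (Eventually.of_forall fun b => abs_nonneg _)
      (hψi.abs.const_mul η) (Eventually.of_forall fun b => ?_))
    dsimp only
    rw [abs_mul]
    exact mul_le_mul_of_nonneg_right (abs_rectSliceKernelTw_sub_one_le ρ J hρ hρu ζ a b) (abs_nonneg _)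
  -- integrate the square
  have hI0 : 0 ≤ ∫ b, |ψ b| ∂(rectSliceMeasure G Ls) := integral_nonneg fun b => abs_nonneg _
  have hsq : ‖d‖ ^ 2 ≤ (η * ‖ψ‖) ^ 2 := by
    rw [norm_sq_eq_integral_sq]
    calc ∫ a, (d a) ^ 2 ∂(rectSliceMeasure G Ls)
        ≤ ∫ a, (η * ∫ b, |ψ b| ∂(rectSliceMeasure G Ls)) ^ 2 ∂(rectSliceMeasure G Ls) := by
          refine integral_mono_ae (Lp.memLp d).integrable_sq (integrable_const _) ?_
          filter_upwards [hdae] with a ha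
          rw [ha]
          have h := hpt a
          rw [← sq_abs]
          exact pow_le_pow_left₀ (abs_nonneg _) h 2
      _ = (η * ∫ b, |ψ b| ∂(rectSliceMeasure G Ls)) ^ 2 := by
          rw [integral_const, smul_eq_mul, probReal_univ, one_mul]
      _ ≤ (η * ‖ψ‖) ^ 2 := by
          rw [mul_pow, mul_pow]
          refine mul_le_mul_of_nonneg_left ?_ (sq_nonneg _)
          rw [norm_sq_eq_integral_sq]
          exact sq_integral_abs_le_integral_sq ψ
  exact (pow_le_pow_iff_left₀ (norm_nonneg _) (mul_nonneg hη0 (norm_nonneg _)) two_ne_zero).1 hsq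

/-- **A unit top eigenvector of the twisted tube operator**: `T_ζ φ₀ = ‖T_ζ‖ φ₀`, `‖φ₀‖ = 1` (compact, self-adjoint, positivity
improving, non-zero). [cite: ReedSimonIV1978, §XIII.12] -/
theorem exists_unit_top_eigenvector_rectTubeTwistedOperator (hρ : Continuous ρ)
    (hρu : ∀ g, ρ g ∈ Matrix.unitaryGroup (Fin n) ℂ) (ζ : RectPlaquette Ls → G) :
    ∃ φ₀ : Lp ℝ 2 (rectSliceMeasure G Ls), ‖φ₀‖ = 1 ∧
      rectTubeTwistedOperator ρ J Ls ζ φ₀ = ‖rectTubeTwistedOperator ρ J Ls ζ‖ • φ₀ := by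
  have hne : rectTubeTwistedOperator ρ J Ls ζ ≠ 0 :=
    norm_pos_iff.1 (norm_rectTubeTwistedOperator_pos (J := J) hρ ζ)
  obtain ⟨ψ, hψ0, hψ⟩ := (isPositivityImproving_rectTubeTwistedOperator (J := J) hρ ζ).exists_top_eigenvector_of_isCompactOperator
    (isSelfAdjoint_rectTubeTwistedOperator (J := J) hρ hρu ζ) (isCompactOperator_rectTubeTwistedOperator (J := J) hρ ζ) hne
  have hn : ‖ψ‖ ≠ 0 := norm_ne_zero_iff.2 hψ0
  refine ⟨‖ψ‖⁻¹ • ψ, ?_, ?_⟩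
  · rw [norm_smul, norm_inv, norm_norm, inv_mul_cancel₀ hn]
  · rw [map_smul, hψ, smul_comm]

/-- `⟪T_ζ x, y⟫ = ⟪x, T_ζ y⟫` (self-adjointness as a symmetric form). [folklore] -/
theorem inner_rectTubeTwistedOperator_comm (hρ : Continuous ρ) (hρu : ∀ g, ρ g ∈ Matrix.unitaryGroup (Fin n) ℂ)
    (ζ : RectPlaquette Ls → G) (x y : Lp ℝ 2 (rectSliceMeasure G Ls)) :
    @inner ℝ _ _ (rectTubeTwistedOperator ρ J Ls ζ x) y = @inner ℝ _ _ x (rectTubeTwistedOperator ρ J Ls ζ y) := by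
  have h := isSelfAdjoint_rectTubeTwistedOperator (J := J) (Ls := Ls) hρ hρu ζ
  rw [ContinuousLinearMap.isSelfAdjoint_iff_isSymmetric] at h
  exact h x y

/-- **THE TOP EIGENVALUE OF THE TWISTED TUBE OPERATOR TO SECOND ORDER**: with `1` the constant unit vector and
`η = e^{|J| n (3#P+N)} − 1 ≤ ¼`,
`|‖T_ζ‖ − (⟪1, T_ζ 1⟫ + ‖T_ζ 1 − ⟪1, T_ζ 1⟫ 1‖²)| ≤ 4 η³`. [cite: Kato1966, §II.2] -/
theorem abs_norm_rectTubeTwistedOperator_sub_second_order_le (hρ : Continuous ρ)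
    (hρu : ∀ g, ρ g ∈ Matrix.unitaryGroup (Fin n) ℂ) (ζ : RectPlaquette Ls → G)
    (hη : Real.exp (|J| * (n * (3 * (Fintype.card (RectTorusSite Ls) * Fintype.card {p : Fin k × Fin k // p.1 < p.2}) +
        Fintype.card (RectTorusSite Ls × Fin k)))) - 1 ≤ 1 / 4) :
    |‖rectTubeTwistedOperator ρ J Ls ζ‖ -
        (@inner ℝ _ _ (Lp.const 2 (rectSliceMeasure G Ls) (1 : ℝ))
            (rectTubeTwistedOperator ρ J Ls ζ (Lp.const 2 (rectSliceMeasure G Ls) (1 : ℝ))) +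
          ‖rectTubeTwistedOperator ρ J Ls ζ (Lp.const 2 (rectSliceMeasure G Ls) (1 : ℝ)) -
              (@inner ℝ _ _ (Lp.const 2 (rectSliceMeasure G Ls) (1 : ℝ))
                (rectTubeTwistedOperator ρ J Ls ζ (Lp.const 2 (rectSliceMeasure G Ls) (1 : ℝ)))) •
                Lp.const 2 (rectSliceMeasure G Ls) (1 : ℝ)‖ ^ 2)| ≤
      4 * (Real.exp (|J| * (n * (3 * (Fintype.card (RectTorusSite Ls) * Fintype.card {p : Fin k × Fin k // p.1 < p.2}) +
        Fintype.card (RectTorusSite Ls × Fin k)))) - 1) ^ 3 := by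
  set η : ℝ := Real.exp (|J| * (n * (3 * (Fintype.card (RectTorusSite Ls) * Fintype.card {p : Fin k × Fin k // p.1 < p.2}) +
        Fintype.card (RectTorusSite Ls × Fin k)))) - 1 with hηdef
  have hη0 : 0 ≤ η := by
    rw [hηdef, sub_nonneg]
    exact Real.one_le_exp (by positivity)
  have he : ‖Lp.const 2 (rectSliceMeasure G Ls) (1 : ℝ)‖ = 1 := by
    rw [Lp.norm_const' (μ := rectSliceMeasure G Ls) (p := 2) (c := (1 : ℝ)) two_ne_zero ENNReal.ofNat_ne_top, norm_one,
      probReal_univ, Real.one_rpow, one_mul]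
  obtain ⟨φ₀, h0, heig⟩ := exists_unit_top_eigenvector_rectTubeTwistedOperator ρ J hρ hρu ζ
  exact abs_norm_sub_second_order_le (rectTubeTwistedOperator ρ J Ls ζ) (inner_rectTubeTwistedOperator_comm ρ J hρ hρu ζ)
    he h0 heig hη0 hη (norm_rectTubeTwistedOperator_sub_rankOne_le ρ J hρ hρu ζ)

/-- **`⟪1, T_ζ 1⟫ = ∫∫ K_ζ(a, b) db da`** (the mean of the kernel). [folklore] -/
theorem inner_one_rectTubeTwistedOperator_one_eq (hρ : Continuous ρ) (ζ : RectPlaquette Ls → G) :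
    @inner ℝ _ _ (Lp.const 2 (rectSliceMeasure G Ls) (1 : ℝ))
        (rectTubeTwistedOperator ρ J Ls ζ (Lp.const 2 (rectSliceMeasure G Ls) (1 : ℝ))) =
      ∫ a, ∫ b, rectSliceKernelTw (Ls := Ls) ρ ζ J J a b ∂(rectSliceMeasure G Ls) ∂(rectSliceMeasure G Ls) := by
  rw [inner_eq_integral]
  refine integral_congr_ae ?_
  filter_upwards [Lp.coeFn_const 2 (rectSliceMeasure G Ls) (1 : ℝ),
    rectTubeTwistedOperator_ae_eq (J := J) hρ ζ (Lp.const 2 (rectSliceMeasure G Ls) (1 : ℝ))] with a h1 hT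
  rw [h1, hT, Function.const_apply, one_mul]
  refine integral_congr_ae ?_
  filter_upwards [Lp.coeFn_const 2 (rectSliceMeasure G Ls) (1 : ℝ)] with b hb
  rw [hb, Function.const_apply, mul_one]

/-- **`‖T_ζ 1 − ⟪1, T_ζ 1⟫ 1‖² = ∫ (∫ K_ζ(a, b) db − ⟪1, T_ζ 1⟫)² da`** (the variance of the row integrals of the kernel).
[folklore] -/
theorem norm_sq_rectTubeTwistedOperator_one_sub_eq (hρ : Continuous ρ) (ζ : RectPlaquette Ls → G) :
    ‖rectTubeTwistedOperator ρ J Ls ζ (Lp.const 2 (rectSliceMeasure G Ls) (1 : ℝ)) -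
        (@inner ℝ _ _ (Lp.const 2 (rectSliceMeasure G Ls) (1 : ℝ))
          (rectTubeTwistedOperator ρ J Ls ζ (Lp.const 2 (rectSliceMeasure G Ls) (1 : ℝ)))) •
          Lp.const 2 (rectSliceMeasure G Ls) (1 : ℝ)‖ ^ 2 =
      ∫ a, (∫ b, rectSliceKernelTw (Ls := Ls) ρ ζ J J a b ∂(rectSliceMeasure G Ls) -
        @inner ℝ _ _ (Lp.const 2 (rectSliceMeasure G Ls) (1 : ℝ))
          (rectTubeTwistedOperator ρ J Ls ζ (Lp.const 2 (rectSliceMeasure G Ls) (1 : ℝ)))) ^ 2 ∂(rectSliceMeasure G Ls) := by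
  set t : ℝ := @inner ℝ _ _ (Lp.const 2 (rectSliceMeasure G Ls) (1 : ℝ))
    (rectTubeTwistedOperator ρ J Ls ζ (Lp.const 2 (rectSliceMeasure G Ls) (1 : ℝ))) with ht
  rw [norm_sq_eq_integral_sq]
  refine integral_congr_ae ?_
  filter_upwards [Lp.coeFn_sub (rectTubeTwistedOperator ρ J Ls ζ (Lp.const 2 (rectSliceMeasure G Ls) (1 : ℝ)))
      (t • Lp.const 2 (rectSliceMeasure G Ls) (1 : ℝ)),
    rectTubeTwistedOperator_ae_eq (J := J) hρ ζ (Lp.const 2 (rectSliceMeasure G Ls) (1 : ℝ)),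
    Lp.coeFn_smul t (Lp.const 2 (rectSliceMeasure G Ls) (1 : ℝ)), Lp.coeFn_const 2 (rectSliceMeasure G Ls) (1 : ℝ)]
    with a ha hTa hsa h1a
  rw [ha, Pi.sub_apply, hTa, hsa, Pi.smul_apply, h1a, Function.const_apply, smul_eq_mul, mul_one]
  congr 2
  refine integral_congr_ae ?_
  filter_upwards [Lp.coeFn_const 2 (rectSliceMeasure G Ls) (1 : ℝ)] with b hb
  rw [hb, Function.const_apply, mul_one]

end Twisted

end Summit.Ventures.YMGap.FlowData
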